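import Literature.NumberTheory.Sieve.BombieriAsymptoticSieveRoughCells
import HarnessLib

/-!
# Bombieri's asymptotic sieve: the odd sector of a Bombieri sequence and the primes' share in it

Topic `Literature/NumberTheory/Sieve`, family `parity`. Proof file (no named fact is introduced),
continuing `BombieriAsymptoticSieveRoughCells.lean` (rough `P_r`-cells `C_r(x,U) = I_r(U) M_r(x) +
o(A(x)/log x)` of a Bombieri sequence, from the named fact `Bombieri1976_PrDistributionMin`,
[BombieriRIMS1977] p. 5 Theorem):

* `roughCellAt` — the rough cell with an EXPLICIT threshold `y` on the least prime factor, and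
  `roughCellAt_isLittleO`: the law `C_r(y; x) = I_r(U) M_r(x) + o(A/log x)` for every threshold
  `y = y(x) > 0` with `log y(x)/log x → 1/U` (monotonicity in the threshold and continuity of `I_r`);
* `roughCellAt_one_eq_sub`, `primeSum_lt_isLittleO` — the cell `r = 1` is the prime count
  `∑_{p ≤ x} a_p` up to `o(A/log x)` (thresholds `≤ √x`, (A₄));
* `oddCells_isLittleO` — the ODD SECTOR `∑_{r odd ≤ R} C_r(y; x) = T_R(U) ∑_{p ≤ x} a_p + o(A/log x)`,
  `T_R(U) = ∑_{r odd ≤ R} I_r(U)` (the parity ghost of the primes is the parity ghost of every odd cell: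
  "once `δ_x` is known, everything is known", [BombieriRIMS1977] p. 5);
* `primeShare_of_floor` — under a FLOOR `∑_{p ≤ x} a_p ≥ δ₀ A(x)/log x` (`δ₀ > 0`), the primes have,
  within the odd sector, the INTEGER share `1/T_R(U)`: `|C₁(y;x)·T_R(U) − Odd_R(y;x)| ≤ ε·Odd_R(y;x)`
  eventually, for every `ε > 0`. Without a floor no such statement follows from (A₁)–(A₅):
  `a_n = 1 + λ(n) + n^{−1/100}·1_{rough P₃}(n)` has all of Bombieri's hypotheses, an empty prime cell
  and a non-empty odd sector.

Consumer: the `Parity/BatemanHorn` crux `OddSectorShareLinear` (stmt-Parity-15629), one-background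
("mixed share anatomy") form, tree
`Summit.Parity.BatemanHorn.Cruxes.OddSectorShareLinear.Birth.OddSectorShareLinear_of_mixedShareAnatomy`.
-/

noncomputable section

open Filter Asymptotics Finset MeasureTheory Set
open scoped Topology ArithmeticFunction.omega

namespace Literature.NumberTheory.Sieve

namespace BombieriRoughCells

/-! ### Rough cells with an explicit threshold -/

/-- The rough `P_r`-cell with an explicit threshold `y` on the least prime factor:
`C_r(y; x) = ∑_{n ≤ x, n squarefree, ω(n) = r, p_min(n) ≥ y} a_n` (`roughCell A r U x = C_r(x^{1/U}; x)`).
[folklore] -/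
def roughCellAt (A : SieveSequence) (r : ℕ) (y x : ℝ) : ℝ :=
  ∑ n ∈ ((Finset.Icc 1 ⌊x⌋₊).filter (fun n : ℕ => Squarefree n ∧ ω n = r)).filter
      (fun n : ℕ => y ≤ (Nat.minFac n : ℝ)), A.a n

/-- `roughCell` is `roughCellAt` at the threshold `x^{1/U}`. [folklore] -/
theorem roughCell_eq_roughCellAt (A : SieveSequence) (r : ℕ) (U x : ℝ) :
    roughCell A r U x = roughCellAt A r (x ^ (1 / U)) x := rfl

/-- The cell is nonnegative. [folklore] -/
theorem roughCellAt_nonneg (A : SieveSequence) (r : ℕ) (y x : ℝ) : 0 ≤ roughCellAt A r y x :=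
  Finset.sum_nonneg fun n _ => A.a_nonneg n

/-- The cell is NONINCREASING in the threshold. [folklore] -/
theorem roughCellAt_anti (A : SieveSequence) (r : ℕ) {y y' : ℝ} (h : y ≤ y') (x : ℝ) :
    roughCellAt A r y' x ≤ roughCellAt A r y x := by
  refine Finset.sum_le_sum_of_subset_of_nonneg (fun n hn => ?_) fun n _ _ => A.a_nonneg n
  rw [Finset.mem_filter] at hn ⊢
  exact ⟨hn.1, h.trans hn.2⟩

/-- **Threshold robustness of the law for the rough cells.** For a Bombieri sequence with density
constant `H`, `r ≥ 2`, `U > 1`, and any positive threshold `y(x)` with `log y(x)/log x → 1/U`: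
`C_r(y(x); x) = I_r(U) M_r(x) + o(A(x)/log x)` (sandwich `x^{1/U₊} ≤ y ≤ x^{1/U₋}` for
`U₋ < U < U₊` close to `U`, the law at `U_±`, and the continuity of `I_r` at `U`). [folklore] -/
theorem roughCellAt_isLittleO (hPr : Bombieri1976_PrDistributionMin) {A : SieveSequence} {H : ℝ}
    (hA : A.IsBombieriSequence) (hH : A.HasDensityConstant H) {r : ℕ} (hr : 2 ≤ r) {U : ℝ}
    (hU : 1 < U) {y : ℝ → ℝ} (hy0 : ∀ᶠ x in atTop, 0 < y x)
    (hy : Tendsto (fun x => Real.log (y x) / Real.log x) atTop (𝓝 (1 / U))) :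
    (fun x : ℝ => roughCellAt A r (y x) x - roughCellDensity r U * mainTerm A H r x) =o[atTop]
      fun x : ℝ => A.size x / Real.log x := by
  have hsize := hA.1
  have hH0 : 0 ≤ H := SieveSequence.HasDensityConstant.nonneg_of_bombieriA1 hH hA.2.1
  have hU0 : 0 < U := by linarith
  obtain ⟨K, hK0, hK⟩ := BombieriP2.chebyshev_primeCount hA hH
  set I : ℝ := roughCellDensity r U with hI_def
  set K₃ : ℝ := 2 * H + K with hK₃
  have hK₃0 : 0 ≤ K₃ := by positivity
  have hXnn : ∀ t, 0 ≤ A.size t := SieveSequence.size_nonneg_of_size_eq hsize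
  rw [isLittleO_iff]
  intro c hc
  -- the window `[U₋, U₊]`
  set ε₁ : ℝ := c / (2 * (K₃ + 1)) with hε₁
  have hε₁0 : 0 < ε₁ := by positivity
  have hε₁K : ε₁ * K₃ ≤ c / 2 := by
    rw [hε₁, div_mul_eq_mul_div, div_le_div_iff₀ (by positivity) (by norm_num)]
    nlinarith
  obtain ⟨ρ, hρ0, hρ⟩ := Metric.continuousAt_iff.mp (continuousAt_roughCellDensity r hU) ε₁ hε₁0
  set ρ' : ℝ := min (ρ / 2) ((U - 1) / 2) with hρ'
  have hρ'0 : 0 < ρ' := lt_min (by linarith) (by linarith)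
  have hρ'ρ : ρ' < ρ := lt_of_le_of_lt (min_le_left _ _) (by linarith)
  have hρ'U : ρ' ≤ (U - 1) / 2 := min_le_right _ _
  set Up : ℝ := U + ρ' with hUp
  set Um : ℝ := U - ρ' with hUm
  have hUm1 : 1 < Um := by rw [hUm]; linarith
  have hUp1 : 1 < Up := by rw [hUp]; linarith
  have hUm0 : 0 < Um := by linarith
  have hUp0 : 0 < Up := by linarith
  have hIUp : roughCellDensity r Up - I < ε₁ := by
    have h := hρ (x := Up) (by rw [Real.dist_eq, hUp, add_sub_cancel_left, abs_of_pos hρ'0]; exact hρ'ρ)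
    rw [Real.dist_eq] at h
    exact lt_of_le_of_lt (le_abs_self _) h
  have hIUm : I - roughCellDensity r Um < ε₁ := by
    have h := hρ (x := Um) (by
      rw [Real.dist_eq, hUm, show U - ρ' - U = -ρ' by ring, abs_neg, abs_of_pos hρ'0]; exact hρ'ρ)
    rw [Real.dist_eq] at h
    exact lt_of_le_of_lt (neg_le_abs _ |>.trans_eq' (by ring)) h
  -- eventually `x^{1/U₊} ≤ y ≤ x^{1/U₋}`
  have hlo : 1 / Up < 1 / U := one_div_lt_one_div_of_lt hU0 (by rw [hUp]; linarith)
  have hhi : 1 / U < 1 / Um := one_div_lt_one_div_of_lt hUm0 (by rw [hUm]; linarith)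
  have hwin : ∀ᶠ x in atTop, 1 / Up < Real.log (y x) / Real.log x ∧ Real.log (y x) / Real.log x < 1 / Um :=
    hy.eventually (Ioo_mem_nhds hlo hhi)
  have hp := (roughCell_isLittleO hPr hA hH hr hUp1).def (show 0 < c / 4 by positivity)
  have hm := (roughCell_isLittleO hPr hA hH hr hUm1).def (show 0 < c / 4 by positivity)
  filter_upwards [hp, hm, hwin, hy0, hK, eventually_gt_atTop (1 : ℝ)] with x hxp hxm hxw hxy hxK hx1
  have hx0 : 0 < x := by linarith
  have hL : 0 < Real.log x := Real.log_pos hx1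
  have hAL : 0 ≤ A.size x / Real.log x := div_nonneg (hXnn x) hL.le
  rw [Real.norm_eq_abs, Real.norm_eq_abs, abs_of_nonneg hAL] at hxp hxm ⊢
  -- the sandwich of the thresholds
  have hy1 : x ^ (1 / Up) ≤ y x := by
    have h1 : 1 / Up * Real.log x < Real.log (y x) := by rw [← lt_div_iff₀ hL]; exact hxw.1
    have h2 := Real.exp_le_exp.mpr h1.le
    rw [Real.exp_log hxy] at h2
    rw [Real.rpow_def_of_pos hx0, mul_comm]
    exact h2
  have hy2 : y x ≤ x ^ (1 / Um) := by
    have h1 : Real.log (y x) < 1 / Um * Real.log x := by rw [← div_lt_iff₀ hL]; exact hxw.2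
    have h2 := Real.exp_le_exp.mpr h1.le
    rw [Real.exp_log hxy] at h2
    rw [Real.rpow_def_of_pos hx0, mul_comm]
    exact h2
  have hcp : roughCellAt A r (y x) x ≤ roughCell A r Up x := by
    rw [roughCell_eq_roughCellAt]; exact roughCellAt_anti A r hy1 x
  have hcm : roughCell A r Um x ≤ roughCellAt A r (y x) x := by
    rw [roughCell_eq_roughCellAt]; exact roughCellAt_anti A r hy2 x
  -- main-term bound and deviations
  have hM : |mainTerm A H r x| ≤ K₃ * A.size x / Real.log x := abs_mainTerm_le hH0 hsize r hx1 hxK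
  have hdp : (roughCellDensity r Up - I) * mainTerm A H r x ≤ ε₁ * (K₃ * A.size x / Real.log x) := by
    have hdev : |roughCellDensity r Up - I| ≤ ε₁ := by
      rw [abs_le]; constructor
      · linarith [monotone_roughCellDensity r (show U ≤ Up by rw [hUp]; linarith)]
      · exact hIUp.le
    calc (roughCellDensity r Up - I) * mainTerm A H r x ≤ |(roughCellDensity r Up - I) * mainTerm A H r x| :=
          le_abs_self _
      _ = |roughCellDensity r Up - I| * |mainTerm A H r x| := abs_mul _ _
      _ ≤ ε₁ * (K₃ * A.size x / Real.log x) := mul_le_mul hdev hM (abs_nonneg _) hε₁0.le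
  have hdm : -(ε₁ * (K₃ * A.size x / Real.log x)) ≤ (roughCellDensity r Um - I) * mainTerm A H r x := by
    have hdev : |roughCellDensity r Um - I| ≤ ε₁ := by
      rw [abs_le]; constructor
      · linarith [hIUm.le]
      · linarith [monotone_roughCellDensity r (show Um ≤ U by rw [hUm]; linarith)]
    calc -(ε₁ * (K₃ * A.size x / Real.log x)) ≤ -|(roughCellDensity r Um - I) * mainTerm A H r x| := by
          rw [neg_le_neg_iff, abs_mul]
          exact mul_le_mul hdev hM (abs_nonneg _) hε₁0.le
      _ ≤ (roughCellDensity r Um - I) * mainTerm A H r x := neg_abs_le _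
  have hεA : ε₁ * (K₃ * A.size x / Real.log x) ≤ c / 2 * (A.size x / Real.log x) := by
    rw [show ε₁ * (K₃ * A.size x / Real.log x) = ε₁ * K₃ * (A.size x / Real.log x) by ring]
    exact mul_le_mul_of_nonneg_right hε₁K hAL
  have ep : (roughCellDensity r Up - I) * mainTerm A H r x =
      roughCellDensity r Up * mainTerm A H r x - I * mainTerm A H r x := by ring
  have em : (roughCellDensity r Um - I) * mainTerm A H r x =
      roughCellDensity r Um * mainTerm A H r x - I * mainTerm A H r x := by ring
  rw [ep] at hdp
  rw [em] at hdm
  have h1 := (abs_le.mp hxp).2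
  have h2 := (abs_le.mp hxm).1
  rw [abs_le]
  constructor <;> linarith

/-! ### The cell `r = 1`: the primes -/

/-- A squarefree `n` with `ω(n) = 1` is a prime. [folklore] -/
theorem prime_of_squarefree_of_card_eq_one {n : ℕ} (hsq : Squarefree n) (hω : ω n = 1) : n.Prime := by
  obtain ⟨p, k, hp, hk, rfl⟩ := ArithmeticFunction.cardDistinctFactors_eq_one_iff.mp hω
  have hp' : p.Prime := hp.nat_prime
  have hk1 : k = 1 := ((Nat.squarefree_pow_iff hp'.ne_one hk.ne') |>.mp hsq).2
  rw [hk1, pow_one]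
  exact hp'

/-- The `P₁`-filter is the set of primes `≤ ⌊x⌋`. [folklore] -/
theorem filter_one_eq_primesLE (x : ℝ) :
    (Finset.Icc 1 ⌊x⌋₊).filter (fun n : ℕ => Squarefree n ∧ ω n = 1) = Nat.primesLE ⌊x⌋₊ := by
  ext n
  simp only [Finset.mem_filter, Finset.mem_Icc, Nat.mem_primesLE]
  constructor
  · rintro ⟨⟨_, hnx⟩, hsq, hω⟩
    exact ⟨hnx, prime_of_squarefree_of_card_eq_one hsq hω⟩
  · rintro ⟨hnx, hp⟩
    exact ⟨⟨hp.one_lt.le, hnx⟩, hp.prime.squarefree,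
      ArithmeticFunction.cardDistinctFactors_apply_prime hp⟩

/-- **The cell `r = 1`** is the prime count above the threshold:
`C₁(y; x) = ∑_{p ≤ x} a_p − ∑_{p ≤ x, p < y} a_p`. [folklore] -/
theorem roughCellAt_one_eq_sub (A : SieveSequence) (y x : ℝ) :
    roughCellAt A 1 y x = (∑ p ∈ Nat.primesLE ⌊x⌋₊, A.a p) -
      ∑ p ∈ (Nat.primesLE ⌊x⌋₊).filter (fun p : ℕ => (p : ℝ) < y), A.a p := by
  unfold roughCellAt
  rw [filter_one_eq_primesLE, eq_sub_iff_add_eq]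
  have hsplit := Finset.sum_filter_add_sum_filter_not (Nat.primesLE ⌊x⌋₊) (fun p : ℕ => y ≤ (p : ℝ))
    (fun p => A.a p)
  have h1 : (Nat.primesLE ⌊x⌋₊).filter (fun n : ℕ => y ≤ (Nat.minFac n : ℝ)) =
      (Nat.primesLE ⌊x⌋₊).filter (fun p : ℕ => y ≤ (p : ℝ)) := by
    refine Finset.filter_congr fun p hp => ?_
    rw [(Nat.mem_primesLE.mp hp).2.minFac_eq]
  have h2 : (Nat.primesLE ⌊x⌋₊).filter (fun p : ℕ => ¬ y ≤ (p : ℝ)) =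
      (Nat.primesLE ⌊x⌋₊).filter (fun p : ℕ => (p : ℝ) < y) := by
    refine Finset.filter_congr fun p _ => ?_
    exact not_le
  rw [h1, ← h2]
  exact hsplit

/-- The primes below a threshold `y(x) ≤ √x` carry `o(A(x)/log x)` ((A₄): `A(√x) = o(A(x)/log x)`).
[folklore] -/
theorem primeSum_lt_isLittleO {A : SieveSequence} (hA : A.IsBombieriSequence) {y : ℝ → ℝ}
    (hy : ∀ᶠ x in atTop, y x ≤ Real.sqrt x) :
    (fun x : ℝ => ∑ p ∈ (Nat.primesLE ⌊x⌋₊).filter (fun p : ℕ => (p : ℝ) < y x), A.a p) =o[atTop]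
      fun x : ℝ => A.size x / Real.log x := by
  have hsize := hA.1
  have hXnn : ∀ t, 0 ≤ A.size t := SieveSequence.size_nonneg_of_size_eq hsize
  have h1 : (fun x : ℝ => ∑ p ∈ (Nat.primesLE ⌊x⌋₊).filter (fun p : ℕ => (p : ℝ) < y x), A.a p)
      =O[atTop] fun x : ℝ => A.size (Real.sqrt x) := by
    refine IsBigO.of_bound 1 ?_
    filter_upwards [hy] with x hxy
    rw [one_mul, Real.norm_eq_abs, Real.norm_eq_abs, abs_of_nonneg (hXnn _),
      abs_of_nonneg (Finset.sum_nonneg fun p _ => A.a_nonneg p)]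
    refine BombieriP2.sum_le_size hsize fun p hp => ?_
    obtain ⟨hp, hpy⟩ := Finset.mem_filter.mp hp
    have hpp := (Nat.mem_primesLE.mp hp).2
    refine Finset.mem_Ioc.mpr ⟨hpp.pos, Nat.le_floor ?_⟩
    exact (hpy.le.trans hxy)
  exact h1.trans_isLittleO (BombieriP2.size_sqrt_isLittleO hA)

/-- **The prime cell**: for thresholds `0 < y(x) ≤ √x`, `C₁(y(x); x) = ∑_{p ≤ x} a_p + o(A(x)/log x)`.
[folklore] -/
theorem roughCellAt_one_isLittleO {A : SieveSequence} (hA : A.IsBombieriSequence) {y : ℝ → ℝ}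
    (hy : ∀ᶠ x in atTop, y x ≤ Real.sqrt x) :
    (fun x : ℝ => roughCellAt A 1 (y x) x - ∑ p ∈ Nat.primesLE ⌊x⌋₊, A.a p) =o[atTop]
      fun x : ℝ => A.size x / Real.log x := by
  refine (primeSum_lt_isLittleO hA hy).neg_left.congr_left fun x => ?_
  simp only [roughCellAt_one_eq_sub]
  ring

/-! ### The odd sector -/

/-- The odd sector up to `R` prime factors: `Odd_R(y; x) = ∑_{r odd, r ≤ R} C_r(y; x)`. [folklore] -/
def oddCells (A : SieveSequence) (R : ℕ) (y x : ℝ) : ℝ :=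
  ∑ r ∈ (Finset.range (R + 1)).filter Odd, roughCellAt A r y x

/-- The odd Buchstab mass up to `R`: `T_R(U) = ∑_{r odd, r ≤ R} I_r(U)`. [folklore] -/
def oddMassR (R : ℕ) (U : ℝ) : ℝ :=
  ∑ r ∈ (Finset.range (R + 1)).filter Odd, roughCellDensity r U

/-- `T_R(U) ≥ I_1(U) = 1` for `U ≥ 1`, `R ≥ 1`. [folklore] -/
theorem one_le_oddMassR {R : ℕ} (hR : 1 ≤ R) {U : ℝ} (hU : 1 ≤ U) : 1 ≤ oddMassR R U := by
  unfold oddMassR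
  have h1 : (1 : ℕ) ∈ (Finset.range (R + 1)).filter Odd :=
    Finset.mem_filter.mpr ⟨Finset.mem_range.mpr (by omega), odd_one⟩
  calc (1 : ℝ) = roughCellDensity 1 U := (roughCellDensity_one_of_one_le hU).symm
    _ ≤ ∑ r ∈ (Finset.range (R + 1)).filter Odd, roughCellDensity r U :=
        Finset.single_le_sum (f := fun r => roughCellDensity r U)
          (fun r _ => roughCellDensity_nonneg r U) h1

/-- The odd sector is nonnegative. [folklore] -/
theorem oddCells_nonneg (A : SieveSequence) (R : ℕ) (y x : ℝ) : 0 ≤ oddCells A R y x :=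
  Finset.sum_nonneg fun r _ => roughCellAt_nonneg A r y x

/-- For odd `r` the main term is the prime count: `M_r(x) = ∑_{p ≤ x} a_p`. [folklore] -/
theorem mainTerm_of_odd (A : SieveSequence) (H : ℝ) {r : ℕ} (hr : Odd r) (x : ℝ) :
    mainTerm A H r x = ∑ p ∈ Nat.primesLE ⌊x⌋₊, A.a p := by
  unfold mainTerm
  rw [hr.neg_one_pow]
  ring

/-- **The odd sector of a Bombieri sequence**: for `U > 1` and thresholds `0 < y(x) ≤ √x` with
`log y(x)/log x → 1/U`, `Odd_R(y(x); x) = T_R(U)·∑_{p ≤ x} a_p + o(A(x)/log x)` — every odd cell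
carries the primes' parity ghost. [folklore] -/
theorem oddCells_isLittleO (hPr : Bombieri1976_PrDistributionMin) {A : SieveSequence} {H : ℝ}
    (hA : A.IsBombieriSequence) (hH : A.HasDensityConstant H) {U : ℝ} (hU : 1 < U) (R : ℕ)
    {y : ℝ → ℝ} (hy0 : ∀ᶠ x in atTop, 0 < y x) (hy2 : ∀ᶠ x in atTop, y x ≤ Real.sqrt x)
    (hy : Tendsto (fun x => Real.log (y x) / Real.log x) atTop (𝓝 (1 / U))) :
    (fun x : ℝ => oddCells A R (y x) x - oddMassR R U * ∑ p ∈ Nat.primesLE ⌊x⌋₊, A.a p) =o[atTop]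
      fun x : ℝ => A.size x / Real.log x := by
  have hterm : ∀ r ∈ (Finset.range (R + 1)).filter Odd,
      (fun x : ℝ => roughCellAt A r (y x) x - roughCellDensity r U * ∑ p ∈ Nat.primesLE ⌊x⌋₊, A.a p)
        =o[atTop] fun x : ℝ => A.size x / Real.log x := by
    intro r hr
    have hro : Odd r := (Finset.mem_filter.mp hr).2
    rcases Nat.lt_or_ge r 2 with h2 | h2
    · -- `r = 1`
      obtain rfl : r = 1 := by
        rcases hro with ⟨j, hj⟩; omega
      have hI : roughCellDensity 1 U = 1 := roughCellDensity_one_of_one_le hU.le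
      rw [hI]
      simpa only [one_mul] using roughCellAt_one_isLittleO hA hy2
    · have h := roughCellAt_isLittleO hPr hA hH h2 hU hy0 hy
      refine h.congr_left fun x => ?_
      simp only [mainTerm_of_odd A H hro]
  have hsum := IsLittleO.sum hterm
  refine hsum.congr' (Eventually.of_forall fun x => ?_) EventuallyEq.rfl
  simp only [oddCells, oddMassR, Finset.sum_sub_distrib, Finset.sum_mul]

/-! ### The primes' share of the odd sector under a floor -/

/-- **The primes have the integer share of the odd sector, given a floor.** For a Bombieri sequence
with density constant `H`, `U > 1`, `R ≥ 1`, thresholds `0 < y(x) ≤ √x` with `log y(x)/log x → 1/U`,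
and a FLOOR `∑_{p ≤ x} a_p ≥ δ₀ A(x)/log x` eventually (`δ₀ > 0`): for every `ε > 0`, eventually in `x`,
`|C₁(y(x); x)·T_R(U) − Odd_R(y(x); x)| ≤ ε·Odd_R(y(x); x)` — within the odd sector the primes have
the share `1/T_R(U) = I_1(U)/∑_{r odd ≤ R} I_r(U)` of Buchstab–Alladi's rough integers. The floor makes
the `o(A/log x)` errors relative; without it the statement does not follow from (A₁)–(A₅) (module
docstring). [folklore] -/
theorem primeShare_of_floor (hPr : Bombieri1976_PrDistributionMin) {A : SieveSequence} {H : ℝ}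
    (hA : A.IsBombieriSequence) (hH : A.HasDensityConstant H) {U : ℝ} (hU : 1 < U) {R : ℕ}
    (hR : 1 ≤ R) {y : ℝ → ℝ} (hy0 : ∀ᶠ x in atTop, 0 < y x) (hy2 : ∀ᶠ x in atTop, y x ≤ Real.sqrt x)
    (hy : Tendsto (fun x => Real.log (y x) / Real.log x) atTop (𝓝 (1 / U))) {δ₀ : ℝ} (hδ₀ : 0 < δ₀)
    (hfloor : ∀ᶠ x in atTop, δ₀ * (A.size x / Real.log x) ≤ ∑ p ∈ Nat.primesLE ⌊x⌋₊, A.a p) :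
    ∀ ε : ℝ, 0 < ε → ∀ᶠ x in atTop,
      |roughCellAt A 1 (y x) x * oddMassR R U - oddCells A R (y x) x| ≤ ε * oddCells A R (y x) x := by
  intro ε hε
  have hsize := hA.1
  have hXnn : ∀ t, 0 ≤ A.size t := SieveSequence.size_nonneg_of_size_eq hsize
  set T : ℝ := oddMassR R U with hT
  have hT1 : 1 ≤ T := one_le_oddMassR hR hU.le
  have hT0 : 0 < T := by linarith
  -- the error budget `c`
  set c : ℝ := δ₀ * min (T / 2) (ε * T / (2 * (T + 1))) with hc
  have hc0 : 0 < c := by rw [hc]; exact mul_pos hδ₀ (lt_min (by positivity) (by positivity))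
  have hcd : c / δ₀ = min (T / 2) (ε * T / (2 * (T + 1))) := by
    rw [hc]; exact mul_div_cancel_left₀ _ hδ₀.ne'
  have hc1 : c / δ₀ ≤ T / 2 := by
    rw [hcd]
    exact min_le_left _ _
  have hc2 : (T + 1) * (c / δ₀) ≤ ε * T / 2 := by
    rw [hcd]
    calc (T + 1) * min (T / 2) (ε * T / (2 * (T + 1))) ≤ (T + 1) * (ε * T / (2 * (T + 1))) :=
          mul_le_mul_of_nonneg_left (min_le_right _ _) (by linarith)
      _ = ε * T / 2 := by field_simp
  have h1 := (roughCellAt_one_isLittleO hA hy2).def hc0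
  have h2 := (oddCells_isLittleO hPr hA hH hU R hy0 hy2 hy).def hc0
  filter_upwards [h1, h2, hfloor, eventually_gt_atTop (1 : ℝ)] with x hx1 hx2 hxf hx
  have hL : 0 < Real.log x := Real.log_pos hx
  have hAL : 0 ≤ A.size x / Real.log x := div_nonneg (hXnn x) hL.le
  rw [Real.norm_eq_abs, Real.norm_eq_abs, abs_of_nonneg hAL] at hx1 hx2
  set P : ℝ := ∑ p ∈ Nat.primesLE ⌊x⌋₊, A.a p with hP
  set C₁ : ℝ := roughCellAt A 1 (y x) x with hC₁
  set O : ℝ := oddCells A R (y x) x with hO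
  have hP0 : 0 ≤ P := primeSum_nonneg A x
  -- errors relative to `P` via the floor
  have hAP : A.size x / Real.log x ≤ P / δ₀ := by
    rw [le_div_iff₀ hδ₀, mul_comm]; exact hxf
  have he1 : |C₁ - P| ≤ c / δ₀ * P := by
    calc |C₁ - P| ≤ c * (A.size x / Real.log x) := hx1
      _ ≤ c * (P / δ₀) := mul_le_mul_of_nonneg_left hAP hc0.le
      _ = c / δ₀ * P := by ring
  have he2 : |O - T * P| ≤ c / δ₀ * P := by
    calc |O - T * P| ≤ c * (A.size x / Real.log x) := hx2
      _ ≤ c * (P / δ₀) := mul_le_mul_of_nonneg_left hAP hc0.le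
      _ = c / δ₀ * P := by ring
  -- `O ≥ (T/2) P`
  have hO : T / 2 * P ≤ O := by
    have := (abs_le.mp he2).1
    nlinarith
  -- `|C₁ T − O| ≤ T|C₁ − P| + |O − TP| ≤ (T+1)(c/δ₀) P ≤ (εT/2) P ≤ ε O`
  have hkey : |C₁ * T - O| ≤ (T + 1) * (c / δ₀) * P := by
    calc |C₁ * T - O| = |T * (C₁ - P) - (O - T * P)| := by ring_nf
      _ ≤ |T * (C₁ - P)| + |O - T * P| := abs_sub _ _
      _ = T * |C₁ - P| + |O - T * P| := by rw [abs_mul, abs_of_pos hT0]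
      _ ≤ T * (c / δ₀ * P) + c / δ₀ * P := add_le_add (mul_le_mul_of_nonneg_left he1 hT0.le) he2
      _ = (T + 1) * (c / δ₀) * P := by ring
  calc |C₁ * T - O| ≤ (T + 1) * (c / δ₀) * P := hkey
    _ ≤ ε * T / 2 * P := mul_le_mul_of_nonneg_right hc2 hP0
    _ = ε * (T / 2 * P) := by ring
    _ ≤ ε * O := mul_le_mul_of_nonneg_left hO hε.le

end BombieriRoughCells

end Literature.NumberTheory.Sieve

end
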